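import Summits.ResolutionOfSingularities.ResolutionOfSingularities.Theorems.WeightedInvariantLocalWeightedDropSpaceNCCountOfCJSB
import Summits.ResolutionOfSingularities.ResolutionOfSingularities.Theorems.WeightedInvariantLocalWeightedDropSpaceCountToTupleDrop
import Summits.ResolutionOfSingularities.ResolutionOfSingularities.Theorems.WeightedInvariantLocalWeightedDropTameResidualOfTupleDrop

/-!
# The N = 4 TAME residual of the engine `LocalWeightedDrop`, banked modulo ⟨F-32bR⟩ and the monomial phase (B3)

[OURS · L1 W4.3 · chain w43, engine crux `LocalWeightedDrop` stmt-ResolutionOfSingularities-8899; strategist res-L1-w43-strat-1's line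
`tame-four-tuple-drop` (`L/res-L1-w43-strat-1/tame_four_tuple_drop_v1.lean` 9c94f6e133b67480); res-type-088] NOT a statement of any
manuscript; the games are the programme's own.

The line's kernel-checked composition `tameWideApexFourStartsWon_of_pieces (hA3) (hB3) (hG3) (hCJS)`, with the pieces that are now
tree theorems plugged in BY NAME: (A3) `TameFourTupleDrop.stub_spaceNonNCCountRad_of_CJS` (p504769), (G3) via the generic assembly
`tupleDropThree_of_count_of_monomialPhase` (p501911) / `tupleDropThree_of_winsIn` (p504571), and the reduction of the N = 4 tame residual
to the three-variable tuple game `Theorems.tameWideApexFourStartsWon_of_tupleDrop` (res-L1-w43-stub-4, p500325).  The ONE remaining stub of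
the line, (B3) `stub_spaceMonomialPhase` — the monomial phase of the three-variable tuple game — enters as an EXPLICIT HYPOTHESIS written
out in the shape of the line's `SpaceMonomialPhase k` (its definition is landed by the (B3) owner); the moment (B3) is a tree theorem the
two results below specialise to unconditional-modulo-⟨F-32bR⟩ statements by `fun k _ => stub_spaceMonomialPhase k`.

* `tupleDropThree_of_CJSB` — F-32bR ∧ (monomial phase over `k`) ⇒ `∀ e, TupleGame.Drop k 3 e`.
* `tameWideApexFourStartsWon_of_CJSB` — F-32bR ∧ (monomial phase over every field) ⇒ the N = 4 TAME residual piece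
  `stub_tameWideApexFourStartsWon` of the registered engine skeleton (residual split v1 db0720e7e4f5f63e), statement VERBATIM.
-/

noncomputable section

open Literature.AlgebraicGeometry.Resolution

set_option linter.dupNamespace false -- mandated namespace of this single-conjunct summit

namespace Summit.ResolutionOfSingularities.ResolutionOfSingularities.Theorems.TameFourTupleDrop

variable {k : Type} [Field k]

/-- **The three-variable tuple game is won modulo ⟨F-32bR⟩ and the monomial phase.** [OURS · L1 W4.3] -/
theorem tupleDropThree_of_CJSB (hCJS : CossartJannsenSaito2020EmbeddedSequenceB.{0})
    (hmono : ∀ e : ℕ, ∃ (β : Ordinal.{0}) (μ : (Fin (e + 1) → MvPowerSeries (Fin 3) k) → Ordinal.{0}),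
      (∀ a, μ a < β) ∧
      ∀ a : Fin (e + 1) → MvPowerSeries (Fin 3) k, a ≠ 0 → TupleGame.Bad a →
        SpaceIsNC (TupleGame.prodSupport a) →
        TupleGame.StepDrop μ (fun b => SpaceIsNC (TupleGame.prodSupport b)) a) :
    ∀ e : ℕ, TupleGame.Drop k 3 e :=
  tupleDropThree_of_winsIn (fun N b d hd hnc hdvd => germIsNC_of_dvd_pow N b d hd hnc hdvd)
    (fun b hb => exists_winsIn_germIsNC_of_CJSB hCJS b hb) hmono

/-- **THE N = 4 TAME RESIDUAL OF THE ENGINE, modulo ⟨F-32bR⟩ and the monomial phase (B3)** — the residual piece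
`stub_tameWideApexFourStartsWon` (= v28's T″ `stub_tameWideApexHigherStartsWon` at `n := 0`), statement VERBATIM: every tame singular
germ (`p ∤ ord f`) in four variables over an algebraically closed field of characteristic `p`, with square tangent quadric, wide apex
and the lower-dimensional / lower-order germs won, is won in the local weighted resolution game. [OURS · L1 W4.3] -/
theorem tameWideApexFourStartsWon_of_CJSB (hCJS : CossartJannsenSaito2020EmbeddedSequenceB.{0})
    (hmono : ∀ (k : Type) [Field k] (e : ℕ),
      ∃ (β : Ordinal.{0}) (μ : (Fin (e + 1) → MvPowerSeries (Fin 3) k) → Ordinal.{0}),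
      (∀ a, μ a < β) ∧
      ∀ a : Fin (e + 1) → MvPowerSeries (Fin 3) k, a ≠ 0 → TupleGame.Bad a →
        SpaceIsNC (TupleGame.prodSupport a) →
        TupleGame.StepDrop μ (fun b => SpaceIsNC (TupleGame.prodSupport b)) a) :
    ∀ (p : ℕ), p.Prime → ∀ (k : Type) [Field k] [CharP k p] [IsAlgClosed k],
    (∀ m : ℕ, m < 4 → ∀ g : MvPowerSeries (Fin m) k,
      CobordantGame.IsSingular k g → CobordantGame.Won k m g) →
    ∀ (f : MvPowerSeries (Fin 4) k), CobordantGame.IsSingular k f →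
    (∀ g : MvPowerSeries (Fin 4) k, CobordantGame.IsSingular k g → g.order < f.order →
      CobordantGame.Won k 4 g) →
    ∀ (d : ℕ), f.order = d → ¬ p ∣ d →
    (∃ ℓ : Fin 4 → k, ∀ i j : Fin 4,
      MvPowerSeries.coeff (Finsupp.single i 1 + Finsupp.single j 1) f =
        MvPowerSeries.coeff (Finsupp.single i 1 + Finsupp.single j 1)
          ((∑ l, MvPowerSeries.C (ℓ l) * MvPowerSeries.X l) ^ 2)) →
    (2 < d → ∃ c₁ c₂ : Fin 4 → k, (∀ α β : k, α • c₁ + β • c₂ = 0 → α = 0 ∧ β = 0) ∧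
      (∀ v : Fin 4 → k, CobordantChart.initEval (fun _ : Fin 4 => 1) (v + c₁) d f =
        CobordantChart.initEval (fun _ : Fin 4 => 1) v d f) ∧
      (∀ v : Fin 4 → k, CobordantChart.initEval (fun _ : Fin 4 => 1) (v + c₂) d f =
        CobordantChart.initEval (fun _ : Fin 4 => 1) v d f)) →
    CobordantGame.Won k 4 f :=
  tameWideApexFourStartsWon_of_tupleDrop fun _ _ k _ _ _ e => tupleDropThree_of_CJSB hCJS (hmono k) e

end Summit.ResolutionOfSingularities.ResolutionOfSingularities.Theorems.TameFourTupleDrop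

end
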